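import Summits.CriticalPhenomena.PercolationContinuityZ3.Theorems.PercNearOneGluingNoHeavyLowerTailIncStarCycle
import Literature.Probability.LatticeModels.ProdBernoulliThinning
import Literature.Probability.Percolation.BlockExplorationBasic
import Literature.Probability.Percolation.AnchoredIsoperimetricProfileProofs
import HarnessLib

/-!
# The cycle theorem in RELATIVE form: an embedded cycle block inside a larger weighted graph

Support file for the Sahi programme (`--supports stmt-CriticalPhenomena-4575`, prover prim-sahi-p2 gen 8).
No definitions, no named facts, no sorries; standard axioms.  Memo `…/prim-sahi-p2/PROOF-E3.md` §19(g).

`…IncStarCycle.lean` proves Sahi positivity of every order for the root-connection events of a weighted cycle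
occupying the WHOLE vertex type `Fin m`.  The cut-vertex composition theorem (`…IncStarCutVertex.lean`) consumes
blocks in relative form: events `{r ↔ x in C}` (`openConnIn C r x`) for a vertex set `C` of a larger graph.
Here the cycle block is supplied in that form: for an injection `c : Fin m → V` (`m ≥ 3`) and a weight `w` on
the pairs of `V` vanishing on the non-consecutive pairs of the image,
`0 ≤ E_n(1_{c 0 ↔ c t₀ in range c}, …)` for all `n` and all targets (`sahiE_rootCluster_embeddedCycle_nonneg`),
and the increasing star `0 ≤ sahiE3 (prodBernoulli w) (openConnIn (range c) (c 0) (c b)) (…) (…)`.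

Proof: the pull-back `ω ↦ {z | Sym2.map c z ∈ ω}` of configurations carries `prodBernoulli w` to
`prodBernoulli (w ∘ Sym2.map c)` (tree: thinning `prodBernoulli_map_thin` followed by complementation
`prodBernoulli_map_compl`) and identifies `{c 0 ↔ c v in range c}` with `{0 ↔ v}` (walks transported along
`c`); `E_n` sees only product moments (`TwoChainUnions.sahiE_congr_of_prodMoments`).
-/

noncomputable section

namespace Summit.CriticalPhenomena.PercolationContinuityZ3.Theorems

namespace IncStarCycle

open Finset MeasureTheory Literature.Combinatorics.Sahi2008 Literature.Probability.Percolation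
  Literature.Probability.LatticeModels
open Literature.Probability.Percolation.DecisionTree (ind ind_of_mem ind_of_not_mem ind_nonneg)
open Literature.Probability.Percolation.BlockExploration (exists_openWalk_of_mem_openConnIn)
open scoped Classical

variable {V : Type*} {m : ℕ}

/-! ### Pulling configurations back along a vertex injection -/

/-- Connection inside the image of an injection `c` is connection of the pulled-back configuration
`{z | Sym2.map c z ∈ ω}`. [this work] -/
theorem openConnIn_range_iff_pullback {c : Fin m → V} (hc : Function.Injective c) (ω : BondConfig V)
    (i j : Fin m) :
    ω ∈ openConnIn (Set.range c) (c i) (c j) ↔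
      ({z : Sym2 (Fin m) | Sym2.map c z ∈ ω} : BondConfig (Fin m)) ∈ openConn i j := by
  set η : BondConfig (Fin m) := {z : Sym2 (Fin m) | Sym2.map c z ∈ ω} with hη
  have hadj : ∀ a b : Fin m, (openGraph η).Adj a b ↔ (openGraph ω).Adj (c a) (c b) := by
    intro a b
    rw [openGraph_adj, openGraph_adj, hη, Set.mem_setOf_eq, Sym2.map_mk, hc.ne_iff]
  constructor
  · intro h
    obtain ⟨p, hp⟩ := exists_openWalk_of_mem_openConnIn h
    -- transport the walk back along `c`
    suffices key : ∀ (x y : V) (q : (openGraph ω).Walk x y), (∀ z ∈ q.support, z ∈ Set.range c) →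
        ∀ a b : Fin m, c a = x → c b = y → (openGraph η).Reachable a b from
      key _ _ p hp i j rfl rfl
    intro x y q
    induction q with
    | nil =>
      intro _ a b ha hb
      have : a = b := hc (ha.trans hb.symm)
      subst this
      exact SimpleGraph.Reachable.refl _
    | @cons x z y hxz q ih =>
      intro hsupp a b ha hb
      have hz : z ∈ Set.range c := hsupp z (by simp)
      obtain ⟨k, rfl⟩ := hz
      subst ha
      have hak : (openGraph η).Adj a k := (hadj a k).2 hxz
      exact hak.reachable.trans (ih (fun u hu => hsupp u (by simp [hu])) k b rfl hb)
  · rintro ⟨q⟩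
    let hom : (openGraph η) →g (openGraph ω) :=
      { toFun := c
        map_rel' := fun {a b} h => (hadj a b).1 h }
    refine mem_openConnIn_of_openWalk ((q.map hom).copy rfl rfl) fun z hz => ?_
    rw [SimpleGraph.Walk.support_copy] at hz
    rw [SimpleGraph.Walk.support_map] at hz
    obtain ⟨u, -, rfl⟩ := List.mem_map.1 hz
    exact ⟨u, rfl⟩

/-- The pull-back of `prodBernoulli w` along `Sym2.map c` (`c` injective) is `prodBernoulli (w ∘ Sym2.map c)`.
[this work] -/
theorem prodBernoulli_map_pullback {c : Fin m → V} (hc : Function.Injective c) (w : Sym2 V → unitInterval) :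
    (prodBernoulli w).map (fun ω : BondConfig V => ({z : Sym2 (Fin m) | Sym2.map c z ∈ ω} : BondConfig (Fin m))) =
      prodBernoulli (w ∘ Sym2.map c) := by
  -- pull-back = complement ∘ thinning along `e = Sym2.map c` on `J = univ`
  let J : Set (Sym2 (Fin m)) := Set.univ
  let e : J → Sym2 V := fun z => Sym2.map c z.1
  have he : Function.Injective e := by
    intro z z' h
    exact Subtype.ext (Sym2.map.injective hc h)
  have hcomp : (fun ω : BondConfig V => ({z : Sym2 (Fin m) | Sym2.map c z ∈ ω} : BondConfig (Fin m))) =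
      compl ∘ thinMap J e := by
    funext ω; ext z
    simp [thinMap, J, e]
  have hmc : Measurable (compl : Set (Sym2 (Fin m)) → Set (Sym2 (Fin m))) :=
    measurable_set_iff.2 fun i => (measurable_set_mem i).not
  rw [hcomp, ← Measure.map_map hmc (measurable_thinMap J e), prodBernoulli_map_thin he, prodBernoulli_map_compl]
  congr 1
  funext z
  simp [thinParam, J, e]

/-- Products of indicators are indicators of intersections. [folklore] -/
theorem prod_ind_eq_ind_iInter {α ι : Type*} (S : Finset ι) (A : ι → Set α) :
    ∏ i ∈ S, ind (A i) = ind (⋂ i ∈ S, A i) := by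
  induction S using Finset.induction_on with
  | empty => funext x; simp [ind_of_mem]
  | insert a S ha ih =>
    rw [Finset.prod_insert ha, ih]
    funext x
    rw [Pi.mul_apply, ← BHK2006.ind_inter]
    congr 1
    ext y
    simp

/-! ### The embedded cycle -/

variable [Fintype V] [NeZero m]

/-- **Sahi positivity of every order for the root-connection events of an EMBEDDED weighted cycle.**  Let
`c : Fin m → V` be injective (`m ≥ 3`) and let `w` vanish on the pairs `s(c i, c j)` that are not consecutive
(`s(i,j) ≠ s(k, k+1)` for all `k`).  Then for every `n` and all `t : Fin n → Fin m`,
`0 ≤ E_n(1_{c 0 ↔ c (t 0) in range c}, …)` under `bernoulliWeight w`. [this work] -/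
theorem sahiE_rootCluster_embeddedCycle_nonneg (hm : 3 ≤ m) {c : Fin m → V} (hc : Function.Injective c)
    (w : Sym2 V → unitInterval)
    (hw : ∀ i j : Fin m, (∀ k : Fin m, s(i, j) ≠ s(k, k + 1)) → w s(c i, c j) = 0)
    (n : ℕ) (t : Fin n → Fin m) :
    0 ≤ sahiE (bernoulliWeight w) n (fun i => ind (openConnIn (Set.range c) (c 0) (c (t i)))) := by
  set Ψ : BondConfig V → BondConfig (Fin m) := fun ω => {z : Sym2 (Fin m) | Sym2.map c z ∈ ω} with hΨ
  have hΨm : Measurable Ψ := by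
    refine measurable_set_iff.2 fun z => ?_
    exact measurable_set_mem (Sym2.map c z)
  -- product moments agree with those of the abstract cycle with weights `w ∘ Sym2.map c`
  have hmom : ∀ S : Finset (Fin n),
      ex (bernoulliWeight w) (∏ i ∈ S, ind (openConnIn (Set.range c) (c 0) (c (t i)))) =
        ex (bernoulliWeight (w ∘ Sym2.map c)) (∏ i ∈ S, ind (openConn (0 : Fin m) (t i))) := by
    intro S
    rw [prod_ind_eq_ind_iInter, prod_ind_eq_ind_iInter, ex_bernoulliWeight_ind, ex_bernoulliWeight_ind]
    have hpre : (⋂ i ∈ S, openConnIn (Set.range c) (c 0) (c (t i)) : Set (BondConfig V)) =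
        Ψ ⁻¹' (⋂ i ∈ S, openConn (0 : Fin m) (t i)) := by
      ext ω
      simp only [Set.mem_iInter, Set.mem_preimage]
      exact forall₂_congr fun i _ => openConnIn_range_iff_pullback hc ω 0 (t i)
    rw [hpre, measureReal_def, measureReal_def, ← Measure.map_apply hΨm MeasurableSet.of_discrete,
      prodBernoulli_map_pullback hc]
  rw [TwoChainUnions.sahiE_congr_of_prodMoments (bernoulliWeight w) (bernoulliWeight (w ∘ Sym2.map c)) n _
    (fun i => ind (openConn (0 : Fin m) (t i))) hmom]
  refine sahiE_rootCluster_cycle_nonneg hm (w ∘ Sym2.map c) (fun e he => ?_) n t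
  induction e using Sym2.ind with
  | _ i j => exact hw i j he

/-- **The increasing star for an embedded cycle block** (relative form, root `c 0`). [this work] -/
theorem incStar_embeddedCycle_nonneg (hm : 3 ≤ m) {c : Fin m → V} (hc : Function.Injective c)
    (w : Sym2 V → unitInterval)
    (hw : ∀ i j : Fin m, (∀ k : Fin m, s(i, j) ≠ s(k, k + 1)) → w s(c i, c j) = 0) (b y z : Fin m) :
    0 ≤ sahiE3 (prodBernoulli w) (openConnIn (Set.range c) (c 0) (c b)) (openConnIn (Set.range c) (c 0) (c y))
      (openConnIn (Set.range c) (c 0) (c z)) := by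
  rw [← sahiE_three_ind]
  have h := sahiE_rootCluster_embeddedCycle_nonneg hm hc w hw 3 ![b, y, z]
  have hf : (fun i : Fin 3 => ind (openConnIn (Set.range c) (c 0) (c ((![b, y, z] : Fin 3 → Fin m) i)))) =
      ![ind (openConnIn (Set.range c) (c 0) (c b)), ind (openConnIn (Set.range c) (c 0) (c y)),
        ind (openConnIn (Set.range c) (c 0) (c z))] := by
    funext i; fin_cases i <;> rfl
  rw [hf] at h
  exact h

/-- **Any root on the embedded cycle**: re-index the embedding by the rotation `· + s`. [this work] -/
theorem sahiE_rootCluster_embeddedCycle_nonneg_rooted (hm : 3 ≤ m) {c : Fin m → V}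
    (hc : Function.Injective c) (w : Sym2 V → unitInterval)
    (hw : ∀ i j : Fin m, (∀ k : Fin m, s(i, j) ≠ s(k, k + 1)) → w s(c i, c j) = 0)
    (s : Fin m) (n : ℕ) (t : Fin n → Fin m) :
    0 ≤ sahiE (bernoulliWeight w) n (fun i => ind (openConnIn (Set.range c) (c s) (c (t i)))) := by
  set c' : Fin m → V := fun i => c (i + s) with hc'
  have hc'i : Function.Injective c' := fun i j h => add_right_cancel (hc h)
  have hrange : Set.range c' = Set.range c := by
    ext x
    constructor
    · rintro ⟨i, rfl⟩; exact ⟨i + s, rfl⟩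
    · rintro ⟨i, rfl⟩; exact ⟨i - s, by simp [hc']⟩
  have hw' : ∀ i j : Fin m, (∀ k : Fin m, s(i, j) ≠ s(k, k + 1)) → w s(c' i, c' j) = 0 := by
    intro i j hij
    refine hw (i + s) (j + s) fun k hk => hij (k - s) ?_
    have h2 := congrArg (Sym2.map fun x : Fin m => x - s) hk
    simp only [Sym2.map_mk, add_sub_cancel_right] at h2
    rw [h2, add_sub_right_comm]
  have key := sahiE_rootCluster_embeddedCycle_nonneg hm hc'i w hw' n (fun i => t i - s)
  have ht : ∀ i, c' (t i - s) = c (t i) := by intro i; simp [hc']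
  have h0 : c' 0 = c s := by simp [hc']
  simp only [hrange, ht, h0] at key
  exact key

end IncStarCycle

end Summit.CriticalPhenomena.PercolationContinuityZ3.Theorems
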